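import Summits.AtomisticToContinuum.Crystallization.Theses.SpectralChargeLedger

/-!
# `ShellsToLayers` (stmt-AtomisticToContinuum-17254), negative side I: compressed fcc chunks are `τ`-good

Support for the negative lemma `shellsToLayers_false_uniformTau`
(`Negative/UniformTauFalse.lean`: the uniform-tolerance strengthening of the crux
`SpectralChargeLedger.ShellsToLayers` — `∃ τ R'` before `∀ R ε` — is false).

* The fcc stacking at `a = 1` and the ideal spacing `h = √(2/3)` is a lattice
  (`fcc_zero_mem`, `fcc_add_mem`, `fcc_sub_mem`) whose squared norms are the integers
  `i² + j² + k² + ij + jk + ki` (`fcc_norm_sq`); hence its vectors of squared norm `< 2` are `0`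
  and unit vectors (`fcc_short`), and it is `4/5`-separated (`fcc_sep`).
* `exists_index_abs_le_one`: a height sequence with increments in `[39/50, 17/20]` passes within
  `1` of `0` (used to find points of a window's layered set near the origin).
* `good_scaled`: in the `λ`-compressed copy of a chunk of such a lattice (`39/40 ≤ λ ≤ 1`), every
  site deep enough inside has its punctured open `r`-shell (`1 < r ≤ 13/10`) in bijection with the
  lattice's punctured `r`-shell, pointwise within `τ` as soon as `(1 - λ) r ≤ τ λ` — i.e. the
  `τ`-matching hypothesis of the crux holds at a FIXED `τ` for arbitrarily large compressed chunks.
All `[folklore]`.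
-/

noncomputable section

open Literature.MathematicalPhysics.StatisticalMechanics Metric Set

namespace Summit.AtomisticToContinuum.Crystallization.Theorems.ShellsToLayers.Negative


/-- fcc points add coordinatewise in the indices (the fcc labels are `L k = k`). [folklore] -/
theorem barlowPos_const_add (h : ℝ) (k i j k' i' j' : ℤ) :
    barlowPos 1 h constHagg k i j + barlowPos 1 h constHagg k' i' j' =
      barlowPos 1 h constHagg (k + k') (i + i') (j + j') := by
  ext l
  fin_cases l <;> simp [barlowPos, triangularVec₁, triangularVec₂, barlowOffset, layerNormal] <;> ring

/-- fcc points subtract coordinatewise in the indices. [folklore] -/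
theorem barlowPos_const_sub (h : ℝ) (k i j k' i' j' : ℤ) :
    barlowPos 1 h constHagg k i j - barlowPos 1 h constHagg k' i' j' =
      barlowPos 1 h constHagg (k - k') (i - i') (j - j') := by
  ext l
  fin_cases l <;> simp [barlowPos, triangularVec₁, triangularVec₂, barlowOffset, layerNormal] <;> ring

/-- The origin is the fcc point `(0, 0, 0)`. [folklore] -/
theorem barlowPos_const_zero (h : ℝ) : barlowPos 1 h constHagg 0 0 0 = 0 := by
  ext l
  fin_cases l <;> simp [barlowPos, triangularVec₁, triangularVec₂, barlowOffset, layerNormal]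

/-- `0 ∈ fcc`. [folklore] -/
theorem fcc_zero_mem (h : ℝ) : (0 : (EuclideanSpace ℝ (Fin 3))) ∈ fccStacking 1 h :=
  ⟨0, 0, 0, (barlowPos_const_zero h).symm⟩

/-- fcc is closed under addition (it is a lattice). [folklore] -/
theorem fcc_add_mem {h : ℝ} {p q : (EuclideanSpace ℝ (Fin 3))} (hp : p ∈ fccStacking 1 h) (hq : q ∈ fccStacking 1 h) :
    p + q ∈ fccStacking 1 h := by
  obtain ⟨k, i, j, rfl⟩ := hp
  obtain ⟨k', i', j', rfl⟩ := hq
  exact ⟨k + k', i + i', j + j', barlowPos_const_add h k i j k' i' j'⟩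

/-- fcc is closed under subtraction (it is a lattice). [folklore] -/
theorem fcc_sub_mem {h : ℝ} {p q : (EuclideanSpace ℝ (Fin 3))} (hp : p ∈ fccStacking 1 h) (hq : q ∈ fccStacking 1 h) :
    p - q ∈ fccStacking 1 h := by
  obtain ⟨k, i, j, rfl⟩ := hp
  obtain ⟨k', i', j', rfl⟩ := hq
  exact ⟨k - k', i - i', j - j', barlowPos_const_sub h k i j k' i' j'⟩

/-- At the ideal ratio `h = √(2/3)` (and `a = 1`) the squared norm of the fcc point `(k, i, j)` is
the integer `i² + j² + k² + ij + jk + ki`. [folklore] -/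
theorem fcc_norm_sq (k i j : ℤ) :
    ‖barlowPos 1 (Real.sqrt (2 / 3)) constHagg k i j‖ ^ 2 =
      ((i ^ 2 + j ^ 2 + k ^ 2 + i * j + j * k + k * i : ℤ) : ℝ) := by
  have h := dist_barlowPos_sq 1 (Real.sqrt (2 / 3)) constHagg k i j 0 0 0
  rw [barlowPos_const_zero, dist_zero_right] at h
  rw [h]
  have h3 : (√3 : ℝ) ^ 2 = 3 := Real.sq_sqrt (by norm_num)
  have h23 : Real.sqrt (2 / 3) ^ 2 = 2 / 3 := Real.sq_sqrt (by norm_num)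
  simp only [haggLabel_const]
  push_cast
  linear_combination (((j : ℝ) + k / 3) ^ 2 / 4) * h3 + ((k : ℝ) ^ 2) * h23

/-- Short fcc vectors: a vector of squared norm `< 2` is zero or a unit vector (the twelve
nearest neighbours). [folklore] -/
theorem fcc_short {p : (EuclideanSpace ℝ (Fin 3))} (hp : p ∈ fccStacking 1 (Real.sqrt (2 / 3))) (h2 : ‖p‖ ^ 2 < 2) :
    p = 0 ∨ ‖p‖ = 1 := by
  obtain ⟨k, i, j, rfl⟩ := hp
  have hQ := fcc_norm_sq k i j
  obtain ⟨n, hn⟩ : ∃ n : ℤ, n = i ^ 2 + j ^ 2 + k ^ 2 + i * j + j * k + k * i := ⟨_, rfl⟩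
  rw [← hn] at hQ
  have h0 : (0 : ℝ) ≤ n := by rw [← hQ]; positivity
  have hlt : (n : ℝ) < 2 := by rw [← hQ]; exact h2
  have h0' : 0 ≤ n := by exact_mod_cast h0
  have hlt' : n < 2 := by exact_mod_cast hlt
  have hnn := norm_nonneg (barlowPos 1 (Real.sqrt (2 / 3)) constHagg k i j)
  rcases (show n = 0 ∨ n = 1 by omega) with h | h
  · left
    have : ‖barlowPos 1 (Real.sqrt (2 / 3)) constHagg k i j‖ ^ 2 = 0 := by rw [hQ, h]; simp
    exact norm_eq_zero.1 (pow_eq_zero_iff two_ne_zero |>.1 this)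
  · right
    have h1 : ‖barlowPos 1 (Real.sqrt (2 / 3)) constHagg k i j‖ ^ 2 = 1 := by rw [hQ, h]; simp
    nlinarith [h1, hnn]

/-- fcc at the ideal ratio is `4/5`-separated (in fact `1`-separated). [folklore] -/
theorem fcc_sep {p q : (EuclideanSpace ℝ (Fin 3))} (hp : p ∈ fccStacking 1 (Real.sqrt (2 / 3)))
    (hq : q ∈ fccStacking 1 (Real.sqrt (2 / 3))) (hne : p ≠ q) : (4 / 5 : ℝ) ≤ dist p q := by
  have := le_dist_of_mem_barlowStacking 1 (Real.sqrt (2 / 3)) constHagg zero_le_one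
    (Real.sqrt_nonneg _) hp hq hne
  have h45 : (4 / 5 : ℝ) ≤ Real.sqrt (2 / 3) := by
    rw [show (4 / 5 : ℝ) = Real.sqrt ((4 / 5) ^ 2) by rw [Real.sqrt_sq (by norm_num)]]
    exact Real.sqrt_le_sqrt (by norm_num)
  exact le_trans (le_min (by norm_num) h45) this

/-- A strictly climbing height sequence with increments in `[39/50, 17/20]` passes within `1` of
`0`. [folklore] -/
theorem exists_index_abs_le_one (z : ℤ → ℝ)
    (hz : ∀ m : ℤ, 39 / 50 ≤ z (m + 1) - z m ∧ z (m + 1) - z m ≤ 17 / 20) :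
    ∃ m : ℤ, |z m| ≤ 1 := by
  have hup : ∀ (m : ℤ) (n : ℕ), z m + 39 / 50 * n ≤ z (m + n) := by
    intro m n
    induction n with
    | zero => simp
    | succ n ih =>
      have h := (hz (m + n)).1
      have : (m : ℤ) + ((n + 1 : ℕ) : ℤ) = m + n + 1 := by push_cast; ring
      rw [this]
      push_cast
      linarith
  classical
  rcases le_or_gt (z 0) 0 with h0 | h0
  · have hex : ∃ n : ℕ, 0 < z n := by
      obtain ⟨n, hn⟩ := exists_nat_gt (-z 0 * 2)
      refine ⟨n, ?_⟩
      have := hup 0 n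
      simp only [zero_add] at this
      linarith
    have hn₀ : 0 < z (Nat.find hex) := Nat.find_spec hex
    have hne : Nat.find hex ≠ 0 := by
      intro h
      rw [h] at hn₀
      push_cast at hn₀
      linarith
    obtain ⟨n₁, hn₁⟩ := Nat.exists_eq_succ_of_ne_zero hne
    have hmin : ¬ 0 < z n₁ := Nat.find_min hex (by omega)
    push Not at hmin
    refine ⟨Nat.find hex, abs_le.2 ⟨by linarith, ?_⟩⟩
    have h2 := (hz n₁).2
    have : ((Nat.find hex : ℕ) : ℤ) = (n₁ : ℤ) + 1 := by rw [hn₁]; push_cast; ring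
    rw [this]
    linarith
  · have hex : ∃ n : ℕ, z (-(n : ℤ)) ≤ 0 := by
      obtain ⟨n, hn⟩ := exists_nat_gt (z 0 * 2)
      refine ⟨n, ?_⟩
      have := hup (-(n : ℤ)) n
      simp only [neg_add_cancel] at this
      linarith
    have hn₀ : z (-(Nat.find hex : ℤ)) ≤ 0 := Nat.find_spec hex
    have hne : Nat.find hex ≠ 0 := by
      intro h
      rw [h] at hn₀
      simp only [CharP.cast_eq_zero, neg_zero] at hn₀
      linarith
    obtain ⟨n₁, hn₁⟩ := Nat.exists_eq_succ_of_ne_zero hne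
    have hmin : ¬ z (-(n₁ : ℤ)) ≤ 0 := Nat.find_min hex (by omega)
    push Not at hmin
    refine ⟨-(n₁ : ℤ), abs_le.2 ⟨by linarith, ?_⟩⟩
    have h2 := (hz (-(Nat.find hex : ℤ))).2
    have : -((Nat.find hex : ℕ) : ℤ) + 1 = -(n₁ : ℤ) := by rw [hn₁]; push_cast; ring
    rw [this] at h2
    linarith

/-- **Scaled lattice chunks are `τ`-good.** If `L` is an additive subgroup of `ℝ³` whose vectors
of squared norm `< 2` are `0` or unit vectors, `C ⊆ L` contains every lattice point of norm
`≤ ρ₀ + r`, and `y` enumerates `λ • C` (`39/40 ≤ λ ≤ 1`, `(1 - λ) r ≤ τ λ`, `1 < r ≤ 13/10`), then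
every site `y j` with `‖y j‖ ≤ λ ρ₀` has its punctured open `r`-shell in bijection with the
punctured `r`-shell `{p ∈ L, p ≠ 0, ‖p‖ < r}` of the lattice, pointwise within `τ` (identity
isometry, bijection `z ↦ λ⁻¹ (z - y j)`). [folklore] -/
theorem good_scaled {L T' : Set (EuclideanSpace ℝ (Fin 3))} (hLadd : ∀ p ∈ L, ∀ q ∈ L, p + q ∈ L)
    (hLsub : ∀ p ∈ L, ∀ q ∈ L, p - q ∈ L)
    (hLshort : ∀ p ∈ L, ‖p‖ ^ 2 < 2 → p = 0 ∨ ‖p‖ = 1)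
    {lam τ r ρ₀ : ℝ} (hlam : 39 / 40 ≤ lam) (hlam1 : lam ≤ 1) (hτ : (1 - lam) * r ≤ τ * lam)
    (hr1 : 1 < r) (hr2 : r ≤ 13 / 10)
    {C : Set (EuclideanSpace ℝ (Fin 3))} (hCL : C ⊆ L) (hC : ∀ c ∈ L, ‖c‖ ≤ ρ₀ + r → c ∈ C)
    {N : ℕ} {y : Fin N → (EuclideanSpace ℝ (Fin 3))} (hy : ∀ zpt : (EuclideanSpace ℝ (Fin 3)), zpt ∈ Set.range y ↔ ∃ c ∈ C, zpt = lam • c)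
    (j : Fin N) (hj : ‖y j‖ ≤ lam * ρ₀) :
    ∃ A : (EuclideanSpace ℝ (Fin 3)) →ₗᵢ[ℝ] (EuclideanSpace ℝ (Fin 3)),
      (∃ e : ↥{zpt : (EuclideanSpace ℝ (Fin 3)) | zpt ∈ Set.range y ∧ zpt ≠ y j ∧ dist zpt (y j) < r} ≃ ↥T',
        ∀ t : ↥{zpt : (EuclideanSpace ℝ (Fin 3)) | zpt ∈ Set.range y ∧ zpt ≠ y j ∧ dist zpt (y j) < r},
          dist ((t : (EuclideanSpace ℝ (Fin 3))) - y j) (A ((e t : ↥T') : (EuclideanSpace ℝ (Fin 3)))) ≤ τ) ∨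
      (∃ e : ↥{zpt : (EuclideanSpace ℝ (Fin 3)) | zpt ∈ Set.range y ∧ zpt ≠ y j ∧ dist zpt (y j) < r} ≃
          ↥{p : (EuclideanSpace ℝ (Fin 3)) | p ∈ L ∧ p ≠ 0 ∧ ‖p‖ < r},
        ∀ t : ↥{zpt : (EuclideanSpace ℝ (Fin 3)) | zpt ∈ Set.range y ∧ zpt ≠ y j ∧ dist zpt (y j) < r},
          dist ((t : (EuclideanSpace ℝ (Fin 3))) - y j) (A ((e t : ↥{p : (EuclideanSpace ℝ (Fin 3)) | p ∈ L ∧ p ≠ 0 ∧ ‖p‖ < r}) : (EuclideanSpace ℝ (Fin 3)))) ≤ τ) := by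
  obtain ⟨cj, hcjC, hyj⟩ := (hy (y j)).1 ⟨j, rfl⟩
  have hlampos : 0 < lam := by linarith
  have hcjL : cj ∈ L := hCL hcjC
  have hcj_norm : ‖cj‖ ≤ ρ₀ := by
    rw [hyj, norm_smul, Real.norm_eq_abs, abs_of_pos hlampos] at hj
    exact le_of_mul_le_mul_left hj hlampos
  refine ⟨LinearIsometry.id, Or.inr ?_⟩
  -- forward map lands in the punctured lattice shell
  have fwd : ∀ zpt : (EuclideanSpace ℝ (Fin 3)), zpt ∈ Set.range y ∧ zpt ≠ y j ∧ dist zpt (y j) < r →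
      lam⁻¹ • (zpt - y j) ∈ L ∧ lam⁻¹ • (zpt - y j) ≠ 0 ∧ ‖lam⁻¹ • (zpt - y j)‖ < r := by
    rintro zpt ⟨hz1, hz2, hz3⟩
    obtain ⟨c, hcC, rfl⟩ := (hy zpt).1 hz1
    have hv : lam⁻¹ • (lam • c - y j) = c - cj := by
      rw [hyj, ← smul_sub, smul_smul, inv_mul_cancel₀ hlampos.ne', one_smul]
    rw [hv]
    have hmem : c - cj ∈ L := hLsub c (hCL hcC) cj hcjL
    have hne : c - cj ≠ 0 := by
      intro h
      apply hz2
      rw [sub_eq_zero.1 h, hyj]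
    have hdist : dist (lam • c) (y j) = lam * ‖c - cj‖ := by
      rw [hyj, dist_smul₀, Real.norm_eq_abs, abs_of_pos hlampos, dist_eq_norm]
    rw [hdist] at hz3
    have hsq : ‖c - cj‖ ^ 2 < 2 := by
      have hn := norm_nonneg (c - cj)
      have h43 : ‖c - cj‖ < 4 / 3 := by nlinarith
      nlinarith
    rcases hLshort _ hmem hsq with h0 | h1
    · exact absurd h0 hne
    · exact ⟨hmem, hne, by rw [h1]; exact hr1⟩
  -- backward map lands in the punctured configuration shell
  have bwd : ∀ p : (EuclideanSpace ℝ (Fin 3)), p ∈ L ∧ p ≠ 0 ∧ ‖p‖ < r →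
      (y j + lam • p) ∈ Set.range y ∧ (y j + lam • p) ≠ y j ∧ dist (y j + lam • p) (y j) < r := by
    rintro p ⟨hp1, hp2, hp3⟩
    refine ⟨?_, ?_, ?_⟩
    · rw [hy]
      refine ⟨cj + p, hC _ (hLadd _ hcjL _ hp1) ?_, by rw [hyj, smul_add]⟩
      calc ‖cj + p‖ ≤ ‖cj‖ + ‖p‖ := norm_add_le _ _
        _ ≤ ρ₀ + r := by linarith
    · intro h
      apply hp2
      have : lam • p = 0 := by simpa using h
      rcases smul_eq_zero.1 this with h' | h'
      · exact absurd h' hlampos.ne'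
      · exact h'
    · rw [dist_eq_norm, add_sub_cancel_left, norm_smul, Real.norm_eq_abs, abs_of_pos hlampos]
      nlinarith [norm_nonneg p]
  let e : ↥{zpt : (EuclideanSpace ℝ (Fin 3)) | zpt ∈ Set.range y ∧ zpt ≠ y j ∧ dist zpt (y j) < r} ≃
      ↥{p : (EuclideanSpace ℝ (Fin 3)) | p ∈ L ∧ p ≠ 0 ∧ ‖p‖ < r} :=
    { toFun := fun t => ⟨lam⁻¹ • ((t : (EuclideanSpace ℝ (Fin 3))) - y j), fwd t t.2⟩
      invFun := fun p => ⟨y j + lam • (p : (EuclideanSpace ℝ (Fin 3))), bwd p p.2⟩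
      left_inv := by
        intro t
        apply Subtype.ext
        simp [smul_smul, mul_inv_cancel₀ hlampos.ne']
      right_inv := by
        intro p
        apply Subtype.ext
        simp [smul_smul, inv_mul_cancel₀ hlampos.ne'] }
  refine ⟨e, fun t => ?_⟩
  show dist ((t : (EuclideanSpace ℝ (Fin 3))) - y j) (lam⁻¹ • ((t : (EuclideanSpace ℝ (Fin 3))) - y j)) ≤ τ
  have ht : dist (t : (EuclideanSpace ℝ (Fin 3))) (y j) < r := t.2.2.2
  rw [dist_eq_norm] at ht
  have hx : ((t : (EuclideanSpace ℝ (Fin 3))) - y j) - lam⁻¹ • ((t : (EuclideanSpace ℝ (Fin 3))) - y j) = (1 - lam⁻¹) • ((t : (EuclideanSpace ℝ (Fin 3))) - y j) := by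
    rw [sub_smul, one_smul]
  have hcoef : 1 - lam⁻¹ ≤ 0 := by
    have : 1 ≤ lam⁻¹ := one_le_inv_iff₀.2 ⟨hlampos, hlam1⟩
    linarith
  rw [dist_eq_norm, hx, norm_smul, Real.norm_eq_abs, abs_of_nonpos hcoef]
  have hinv : -(1 - lam⁻¹) = (1 - lam) / lam := by
    field_simp
    ring
  rw [hinv, div_mul_eq_mul_div, div_le_iff₀ hlampos]
  have h1l : 0 ≤ 1 - lam := by linarith
  calc (1 - lam) * ‖(t : (EuclideanSpace ℝ (Fin 3))) - y j‖ ≤ (1 - lam) * r :=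
        mul_le_mul_of_nonneg_left ht.le h1l
    _ ≤ τ * lam := hτ

end Summit.AtomisticToContinuum.Crystallization.Theorems.ShellsToLayers.Negative

end
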